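import Summits.CriticalPhenomena.PercolationContinuityZ3.Theorems.PercNearOneGluingNoHeavyLowerTailNetworkFoldGlue
import HarnessLib

/-!
# `NoHeavyLowerTail` (stmt-CriticalPhenomena-4575) — HUB PAIRS WITH A TERMINAL ALONE ON ITS SIDE (the 2|1 split), part 1:
# a terminal arm glued at `{h₀, h₁}` is seen by the rest through the partition of `{c, h₀, h₁}` and two separation flags

Support file (prover prim-gen-kcluster gen 72; `--supports stmt-CriticalPhenomena-4575`).  Pure graph combinatorics: no measures, no definitions,
no named facts, no sorries.  SETTING (KCLUSTER-gen65 §10(c)/§11, here with an ARBITRARY near side): a TERMINAL ARM is a pair set `ζ_X ⊆ DX` containing the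
terminal `c` and meeting the rest `ζ_K ⊆ DK` (which contains the apex `a` and the terminal `b`) only in the hubs `h₀, h₁`; `a, b` lie on no pair of `DX`,
`c` on no pair of `DK`.
* `HubPairTerm.exists_hub_of_mem_cl` — an `X`-private vertex joined to a `K`-private one is joined, inside the arm, to a hub of the joint cluster
  (the last hub on the path); `mem_cl_private_iff`;
* `HubPairTerm.sep_master` — for `b, c ∉ W = C(a)`: `Sep (DX ∪ DK) W b c` iff for each hub `h`: `h ∈ W`, or `b` does not reach `h` in `DK` off `W`, or
  the OTHER hub lies in `W` and its arm cluster separates `c` from `h` in `DX` (the FLAG `N`); here the arm enters only through `J = [h₁ ∈ C_X(h₀)]`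
  (via `NetworkFold`), the partition of `{c, h₀, h₁}` and the two flags.
Parts 2–4 (`…HubPairTerm`, `…HubPairTermCells`, `…HubPairTermMain`) turn this into the 2|1 dictionary and KCLUSTER-gen65 §11's reduction of R1 across a
terminal-isolating hub pair to three R1 instances and four hub-cross rows of the near side (`Split21`), at the measure level.
-/

namespace Summit.CriticalPhenomena.PercolationContinuityZ3.Theorems

namespace HubPairTerm

open SimpleGraph Finset Literature.Probability.Percolation Literature.Probability.Percolation.Gladkov
open Literature.Probability.LatticeModels RefinedRowR3 ThreePointLB APL
open scoped Classical

variable {V : Type*} [Fintype V]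

/-! ### The last hub on a path from the arm to the rest -/

section LastHub

variable {ζX ζK : Finset (Sym2 V)} {h₀ h₁ x z : V}
  (hsep : ∀ t : V, (∃ e ∈ ζX, t ∈ e) → (∃ e ∈ ζK, t ∈ e) → (t = h₀ ∨ t = h₁))
include hsep

/-- **The last hub.**  If `z` lies on no pair of `ζ_K`, `x` on no pair of `ζ_X`, `z ≠ x` and `z ∈ cl (ζ_X ∪ ζ_K) x`, then some hub `g` of the
cluster satisfies `z ∈ cl ζ_X g`. [this work] -/
theorem exists_hub_of_mem_cl (hz : ∀ e ∈ ζK, z ∉ e) (hx : ∀ e ∈ ζX, x ∉ e) (hzx : z ≠ x)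
    (h : z ∈ cl (ζX ∪ ζK) x) : ∃ g : V, (g = h₀ ∨ g = h₁) ∧ g ∈ cl (ζX ∪ ζK) x ∧ z ∈ cl ζX g := by
  -- walk version, from the arm side
  have key : ∀ (u y : V) (p : (openGraph (↑(ζX ∪ ζK) : Set (Sym2 V))).Walk u y), (∀ e ∈ ζK, u ∉ e) → (∀ e ∈ ζX, y ∉ e) → u ≠ y →
      ∃ g : V, (g = h₀ ∨ g = h₁) ∧ (openGraph (↑(ζX ∪ ζK) : Set (Sym2 V))).Reachable g y ∧ u ∈ cl ζX g := by
    intro u y p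
    induction p with
    | nil => intro _ _ hne; exact absurd rfl hne
    | @cons u u' y huu' p' ih =>
      intro hu hy hux
      have huu : s(u, u') ∈ ζX := by
        have h1 := huu'
        rw [openGraph_adj, Finset.mem_coe, Finset.mem_union] at h1
        rcases h1.1 with h1 | h1
        · exact h1
        · exact absurd (Sym2.mem_mk_left u u') (hu _ h1)
      have hne : u ≠ u' := by
        have h1 := huu'; rw [openGraph_adj] at h1; exact h1.2
      have hadjX : (openGraph (↑ζX : Set (Sym2 V))).Adj u u' := by
        rw [openGraph_adj, Finset.mem_coe]; exact ⟨huu, hne⟩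
      by_cases hg : u' = h₀ ∨ u' = h₁
      · exact ⟨u', hg, ⟨p'⟩, mem_cl_comm.1 (mem_cl_of_adj (mem_cl_self _ u) hadjX)⟩
      · -- `u'` is again private to the arm and different from `y`
        have hu' : ∀ e ∈ ζK, u' ∉ e := fun e he hue =>
          hg (hsep u' ⟨_, huu, Sym2.mem_mk_right u u'⟩ ⟨e, he, hue⟩)
        have hu'y : u' ≠ y := fun h' => hy _ huu (h' ▸ Sym2.mem_mk_right u u')
        obtain ⟨g, hg', hgy, hu'g⟩ := ih hu' hy hu'y
        exact ⟨g, hg', hgy, mem_cl_of_adj hu'g hadjX.symm⟩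
  obtain ⟨p⟩ := mem_cl.1 (mem_cl_comm.1 h)
  obtain ⟨g, hg, hgx, hzg⟩ := key z x p hz hx hzx
  exact ⟨g, hg, mem_cl.2 hgx.symm, hzg⟩

/-- **An arm-private vertex lies in the cluster of a rest-private vertex iff it lies in the arm cluster of a hub of that cluster.** [this work] -/
theorem mem_cl_private_iff (hz : ∀ e ∈ ζK, z ∉ e) (hx : ∀ e ∈ ζX, x ∉ e) (hzx : z ≠ x) :
    z ∈ cl (ζX ∪ ζK) x ↔ ∃ g : V, (g = h₀ ∨ g = h₁) ∧ g ∈ cl (ζX ∪ ζK) x ∧ z ∈ cl ζX g :=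
  ⟨exists_hub_of_mem_cl hsep hz hx hzx, fun ⟨g, _, hgx, hzg⟩ => mem_cl_trans hgx (cl_mono Finset.subset_union_left g hzg)⟩

end LastHub

/-! ### Clusters of arm vertices, and one edge between the hubs -/

section ArmSide

variable {ζX ζK : Finset (Sym2 V)} {a h₀ h₁ : V}
  (hsep : ∀ t : V, (∃ e ∈ ζX, t ∈ e) → (∃ e ∈ ζK, t ∈ e) → (t = h₀ ∨ t = h₁)) (haX : ∀ e ∈ ζX, a ∉ e)
include hsep haX

/-- **Arm vertices in the cluster of `a`** (`a` on no arm pair): a vertex on no pair of the rest, different from `a`, lies in `C(a)` iff it lies in the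
arm cluster of a hub of `C(a)`. [this work] -/
theorem arm_mem_cl_iff {t : V} (ht : ∀ e ∈ ζK, t ∉ e) (hta : t ≠ a) :
    t ∈ cl (ζX ∪ ζK) a ↔ ∃ g : V, (g = h₀ ∨ g = h₁) ∧ g ∈ cl (ζX ∪ ζK) a ∧ t ∈ cl ζX g :=
  mem_cl_private_iff hsep ht haX hta

end ArmSide

omit [Fintype V] in
/-- Reaching a hub through the rest plus the single pair `h₀h₁`: `h ∈ cl ({h₀h₁} ∪ S) b ↔ h₀ ∈ cl S b ∨ h₁ ∈ cl S b` for a hub `h` and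
`b ≠ h₀, h₁`. [folklore] -/
theorem mem_cl_hubEdge_iff [Fintype V] {S : Finset (Sym2 V)} {b h₀ h₁ h : V} (hb0 : b ≠ h₀) (hb1 : b ≠ h₁) (h01 : h₀ ≠ h₁)
    (hh : h = h₀ ∨ h = h₁) :
    h ∈ cl ({s(h₀, h₁)} ∪ S) b ↔ (h₀ ∈ cl S b ∨ h₁ ∈ cl S b) := by
  have hsep1 : ∀ t : V, (∃ e ∈ ({s(h₀, h₁)} : Finset (Sym2 V)), t ∈ e) → (∃ e ∈ S, t ∈ e) → (t = b ∨ t = h₀ ∨ t = h₁) := by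
    rintro t ⟨e, he, hte⟩ -
    rw [Finset.mem_singleton] at he; subst he
    exact Or.inr (Sym2.mem_iff.1 hte)
  have e01 : h₁ ∈ cl ({s(h₀, h₁)} : Finset (Sym2 V)) h₀ :=
    mem_cl_of_adj (mem_cl_self _ _) (by rw [openGraph_adj, Finset.mem_coe]; exact ⟨Finset.mem_singleton_self _, h01⟩)
  have nb : ∀ t, t ∈ cl ({s(h₀, h₁)} : Finset (Sym2 V)) b → t = b := fun t ht =>
    ApexTwoSum.eq_of_mem_cl_of_forall_not_mem (fun e he hbe => by
      rw [Finset.mem_singleton] at he; subst he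
      exact (Sym2.mem_iff.1 hbe).elim hb0 hb1) ht
  rcases hh with rfl | rfl
  · rw [APL.glued_ab_iff _ _ b h h₁ hsep1]
    constructor
    · rintro ((h1 | h1) | ⟨h2 | h2, h3⟩)
      · exact absurd (nb _ h1).symm hb0
      · exact Or.inl h1
      · exact absurd (nb _ h2).symm hb1
      · exact Or.inr h2
    · rintro (h1 | h1)
      · exact Or.inl (Or.inr h1)
      · exact Or.inr ⟨Or.inr h1, Or.inl (mem_cl_comm.1 e01)⟩
  · rw [APL.glued_ac_iff _ _ b h₀ h hsep1]
    constructor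
    · rintro ((h1 | h1) | ⟨h2 | h2, h3⟩)
      · exact absurd (nb _ h1).symm hb1
      · exact Or.inr h1
      · exact absurd (nb _ h2).symm hb0
      · exact Or.inl h2
    · rintro (h1 | h1)
      · exact Or.inr ⟨Or.inr h1, Or.inl e01⟩
      · exact Or.inl (Or.inr h1)

/-! ### The master separation rule for a terminal arm -/

section Master

variable {DX DK ζX ζK : Finset (Sym2 V)} {a b c h₀ h₁ : V} (h01 : h₀ ≠ h₁) (hb0 : b ≠ h₀) (hb1 : b ≠ h₁) (hc0 : c ≠ h₀) (hc1 : c ≠ h₁)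
  (hbc : b ≠ c)
  (hsepD : ∀ t : V, (∃ e ∈ DX, t ∈ e) → (∃ e ∈ DK, t ∈ e) → (t = h₀ ∨ t = h₁))
  (hζX : ζX ⊆ DX) (hζK : ζK ⊆ DK) (haX : ∀ e ∈ DX, a ∉ e) (hbX : ∀ e ∈ DX, b ∉ e) (hcK : ∀ e ∈ DK, c ∉ e)
  (hcX0 : c ∈ cl DX h₀) (hcX1 : c ∈ cl DX h₁)
include h01 hb0 hb1 hc0 hc1 hbc hsepD hζX hζK haX hbX hcK hcX0 hcX1

/-- **Master separation rule for a terminal arm.**  Let `W = C(a)` in `ζ_X ∪ ζ_K`.  Then `W` separates `b` from `c` in the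
support `DX ∪ DK` iff for each hub `h`: `h ∈ W`, or `b` does not reach `h` in `DK` off `W`, or the other hub `h'` lies in `W` and its arm cluster
`C_X(h')` separates `h` from `c` in `DX` (the flag). [this work] -/
theorem sep_master :
    Sep (DX ∪ DK) (cl (ζX ∪ ζK) a) b c ↔
      ((h₀ ∈ cl (ζX ∪ ζK) a ∨ h₀ ∉ cl (DK \ touch (cl (ζX ∪ ζK) a)) b ∨
          (h₁ ∈ cl (ζX ∪ ζK) a ∧ Sep DX (cl ζX h₁) h₀ c)) ∧
        (h₁ ∈ cl (ζX ∪ ζK) a ∨ h₁ ∉ cl (DK \ touch (cl (ζX ∪ ζK) a)) b ∨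
          (h₀ ∈ cl (ζX ∪ ζK) a ∧ Sep DX (cl ζX h₀) h₁ c))) := by
  set W := cl (ζX ∪ ζK) a with hW
  set SX := DX \ touch W with hSX
  set SK := DK \ touch W with hSK
  have hsep : ∀ t : V, (∃ e ∈ ζX, t ∈ e) → (∃ e ∈ ζK, t ∈ e) → (t = h₀ ∨ t = h₁) :=
    fun t ⟨e, he, hte⟩ ⟨f, hf, htf⟩ => hsepD t ⟨e, hζX he, hte⟩ ⟨f, hζK hf, htf⟩
  have hsepS : ∀ t : V, (∃ e ∈ SX, t ∈ e) → (∃ e ∈ SK, t ∈ e) → (t = h₀ ∨ t = h₁) :=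
    fun t ⟨e, he, hte⟩ ⟨f, hf, htf⟩ => hsepD t ⟨e, (Finset.mem_sdiff.1 he).1, hte⟩ ⟨f, (Finset.mem_sdiff.1 hf).1, htf⟩
  -- a hub of `W` lies on no surviving pair
  have noS : ∀ {g : V}, g ∈ W → ∀ {T : Finset (Sym2 V)} (e : Sym2 V), e ∈ T \ touch W → g ∉ e := fun hg T e he hge =>
    (Finset.mem_sdiff.1 he).2 (mem_touch.2 ⟨_, hg, hge⟩)
  have noReach : ∀ {g t : V}, g ∈ W → t ≠ g → ∀ {T : Finset (Sym2 V)}, t ∉ cl (T \ touch W) g := fun hg htg T ht =>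
    htg (ApexTwoSum.eq_of_mem_cl_of_forall_not_mem (fun e he hge => noS hg e he hge) ht)
  -- arm vertices of `W` hang on a hub of `W`
  have armW : ∀ {t : V} (e : Sym2 V), e ∈ DX → t ∈ e → t ∈ W → ∃ g : V, (g = h₀ ∨ g = h₁) ∧ g ∈ W ∧ t ∈ cl ζX g := by
    intro t e he hte htW
    by_cases htg : t = h₀ ∨ t = h₁
    · rcases htg with rfl | rfl
      · exact ⟨_, Or.inl rfl, htW, mem_cl_self _ _⟩
      · exact ⟨_, Or.inr rfl, htW, mem_cl_self _ _⟩
    · have htK : ∀ f ∈ ζK, t ∉ f := fun f hf htf => htg (hsepD t ⟨e, he, hte⟩ ⟨f, hζK hf, htf⟩)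
      have hta : t ≠ a := fun h => haX e he (h ▸ hte)
      exact (arm_mem_cl_iff hsep (fun f hf => haX f (hζX hf)) htK hta).1 htW
  unfold RefinedRowR3.Sep
  rw [Finset.union_sdiff_distrib]
  -- `c ∈ cl (SX ∪ SK) b` iff some hub is reached and joins `c` inside `SX`
  have key : c ∈ cl (SX ∪ SK) b ↔ ∃ g : V, (g = h₀ ∨ g = h₁) ∧ g ∈ cl (SX ∪ SK) b ∧ c ∈ cl SX g :=
    mem_cl_private_iff hsepS (fun f hf => hcK f (Finset.mem_sdiff.1 hf).1) (fun e he => hbX e (Finset.mem_sdiff.1 he).1) hbc.symm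
  change ¬ (c ∈ cl (SX ∪ SK) b) ↔ _
  rw [key]
  by_cases g0 : h₀ ∈ W <;> by_cases g1 : h₁ ∈ W
  · -- both hubs in `W`: nothing gets through
    refine ⟨fun _ => ⟨Or.inl g0, Or.inl g1⟩, fun _ => ?_⟩
    rintro ⟨g, hg, -, hcg⟩
    rcases hg with rfl | rfl
    · exact noReach g0 hc0 hcg
    · exact noReach g1 hc1 hcg
  · -- `h₀ ∈ W`, `h₁ ∉ W`: the arm off `W` is `DX ∖ touch C_X(h₀)`
    have hSX' : SX = DX \ touch (cl ζX h₀) := by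
      ext e
      simp only [hSX, Finset.mem_sdiff, mem_touch, not_exists, not_and]
      constructor
      · rintro ⟨he, h1⟩
        exact ⟨he, fun t ht hte => h1 t (mem_cl_trans g0 (cl_mono Finset.subset_union_left h₀ ht)) hte⟩
      · rintro ⟨he, h1⟩
        refine ⟨he, fun t htW hte => ?_⟩
        obtain ⟨g, hg, hgW, htg⟩ := armW e he hte htW
        rcases hg with rfl | rfl
        · exact h1 t htg hte
        · exact g1 hgW
    constructor
    · intro hno
      refine ⟨Or.inl g0, Or.inr ?_⟩
      by_cases r1 : h₁ ∈ cl SK b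
      · refine Or.inr ⟨g0, ?_⟩
        intro hc'
        -- then `c` would be reached through `h₁`
        apply hno
        refine ⟨h₁, Or.inr rfl, cl_mono Finset.subset_union_right b r1, ?_⟩
        rw [hSX']; exact hc'
      · exact Or.inl r1
    · rintro ⟨-, hF1⟩ ⟨g, hg, hgb, hcg⟩
      rcases hg with rfl | rfl
      · exact noReach g0 hc0 hcg
      · -- `g = h₁`: `b` reaches `h₁` off `W` inside `DK` and `C_X(h₀)` does not cut `c` from `h₁`
        have hJ : g ∉ cl SX h₀ := noReach g0 h01.symm
        have r1 : g ∈ cl SK b := by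
          have e1 := NetworkFold.mem_cl_replace (ζX := SX) (ζX' := (∅ : Finset (Sym2 V))) (ζY := SK) (u := h₀) (v := g) (x := b) (y := g)
            hsepS (fun t ⟨e, he, _⟩ _ => absurd he (Finset.notMem_empty e))
            (fun e he hbe => absurd hbe (hbX e (Finset.mem_sdiff.1 he).1)) (fun e he _ => absurd he (Finset.notMem_empty e))
            (fun _ _ _ => Or.inr rfl) (fun e he _ => absurd he (Finset.notMem_empty e))
            ⟨fun h => absurd h hJ, fun h => absurd h (NetworkFold.not_mem_cl_empty h01)⟩
          rw [Finset.empty_union] at e1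
          exact e1.1 hgb
        rcases hF1 with h' | h' | ⟨-, hN⟩
        · exact g1 h'
        · exact h' r1
        · rw [← hSX'] at hN
          exact hN hcg
  · -- `h₀ ∉ W`, `h₁ ∈ W`: symmetric
    have hSX' : SX = DX \ touch (cl ζX h₁) := by
      ext e
      simp only [hSX, Finset.mem_sdiff, mem_touch, not_exists, not_and]
      constructor
      · rintro ⟨he, h1⟩
        exact ⟨he, fun t ht hte => h1 t (mem_cl_trans g1 (cl_mono Finset.subset_union_left h₁ ht)) hte⟩
      · rintro ⟨he, h1⟩
        refine ⟨he, fun t htW hte => ?_⟩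
        obtain ⟨g, hg, hgW, htg⟩ := armW e he hte htW
        rcases hg with rfl | rfl
        · exact g0 hgW
        · exact h1 t htg hte
    constructor
    · intro hno
      refine ⟨Or.inr ?_, Or.inl g1⟩
      by_cases r0 : h₀ ∈ cl SK b
      · refine Or.inr ⟨g1, ?_⟩
        intro hc'
        apply hno
        refine ⟨h₀, Or.inl rfl, cl_mono Finset.subset_union_right b r0, ?_⟩
        rw [hSX']; exact hc'
      · exact Or.inl r0
    · rintro ⟨hF0, -⟩ ⟨g, hg, hgb, hcg⟩
      rcases hg with rfl | rfl
      · have hJ : h₁ ∉ cl SX g := fun h => noReach g1 h01 (mem_cl_comm.1 h)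
        have r0 : g ∈ cl SK b := by
          have e1 := NetworkFold.mem_cl_replace (ζX := SX) (ζX' := (∅ : Finset (Sym2 V))) (ζY := SK) (u := g) (v := h₁) (x := b) (y := g)
            hsepS (fun t ⟨e, he, _⟩ _ => absurd he (Finset.notMem_empty e))
            (fun e he hbe => absurd hbe (hbX e (Finset.mem_sdiff.1 he).1)) (fun e he _ => absurd he (Finset.notMem_empty e))
            (fun _ _ _ => Or.inl rfl) (fun e he _ => absurd he (Finset.notMem_empty e))
            ⟨fun h => absurd h hJ, fun h => absurd h (NetworkFold.not_mem_cl_empty h01)⟩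
          rw [Finset.empty_union] at e1
          exact e1.1 hgb
        rcases hF0 with h' | h' | ⟨-, hN⟩
        · exact g0 h'
        · exact h' r0
        · rw [← hSX'] at hN
          exact hN hcg
      · exact noReach g1 hc1 hcg
  · -- no hub in `W`: the arm is untouched and joins everything
    have hSX' : SX = DX := by
      refine Finset.sdiff_eq_self_of_disjoint (Finset.disjoint_left.2 fun e he heT => ?_)
      obtain ⟨t, htW, hte⟩ := mem_touch.1 heT
      obtain ⟨g, hg, hgW, -⟩ := armW e he hte htW
      rcases hg with rfl | rfl
      · exact g0 hgW
      · exact g1 hgW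
    have hJ : h₁ ∈ cl SX h₀ := by rw [hSX']; exact mem_cl_trans hcX0 (mem_cl_comm.1 hcX1)
    -- reaching a hub in `SX ∪ SK` = reaching some hub in `SK`
    have hub_iff : ∀ {g : V}, (g = h₀ ∨ g = h₁) → (g ∈ cl (SX ∪ SK) b ↔ (h₀ ∈ cl SK b ∨ h₁ ∈ cl SK b)) := by
      intro g hg
      have e1 := NetworkFold.mem_cl_replace (ζX := SX) (ζX' := ({s(h₀, h₁)} : Finset (Sym2 V))) (ζY := SK) (u := h₀) (v := h₁) (x := b) (y := g)
        hsepS (NetworkFold.hsep_single SK)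
        (fun e he hbe => absurd hbe (hbX e (Finset.mem_sdiff.1 he).1)) (NetworkFold.not_inner_single b)
        (fun _ _ _ => hg) (NetworkFold.not_inner_single g)
        ⟨fun _ => NetworkFold.mem_cl_single h01, fun _ => hJ⟩
      rw [e1]
      exact mem_cl_hubEdge_iff hb0 hb1 h01 hg
    constructor
    · intro hno
      have hnot : ¬ (h₀ ∈ cl SK b ∨ h₁ ∈ cl SK b) := by
        intro hr
        apply hno
        refine ⟨h₀, Or.inl rfl, (hub_iff (Or.inl rfl)).2 hr, ?_⟩
        rw [hSX']; exact hcX0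
      exact ⟨Or.inr (Or.inl fun h => hnot (Or.inl h)), Or.inr (Or.inl fun h => hnot (Or.inr h))⟩
    · rintro ⟨hF0, hF1⟩ ⟨g, hg, hgb, -⟩
      have hr := (hub_iff hg).1 hgb
      rcases hF0 with h' | h' | ⟨h', -⟩
      · exact g0 h'
      · rcases hF1 with h'' | h'' | ⟨h'', -⟩
        · exact g1 h''
        · exact hr.elim h' h''
        · exact g0 h''
      · exact g1 h'

end Master


end HubPairTerm

end Summit.CriticalPhenomena.PercolationContinuityZ3.Theorems
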